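import Literature.Barriers.QuantumAdvantage.BoundedEntanglementConjugateBound
import HarnessLib

/-!
# Small facts about the stages of a `p`-blocked computation used by the machine specification

Topic `Literature/Barriers/QuantumAdvantage`; auxiliary file of the proof programme for the named
fact `Literature.Barriers.QuantumAdvantage.jozsaLinden2003_pblocked` (Jozsa–Linden 2003, §3). The
specification of the classical machine (`PBlockedSim.lean`) against the canonical block data
(`blocksAfter`, `gramZ B (ampZ F x j)`) needs a handful of facts about the quantum side that the
earlier files do not state in the required form; they are collected here (no definition, no named
fact):

* `hExp_mono`, `hExp_le_length` — the Hadamard count grows along the computation and is at most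
  the number of gates; **`natAbs_gramZ_ampZ_lt_two_pow`** — with a width `W ≥ h_final + 2` every
  coordinate of every block datum at every stage is `< 2^W` in absolute value (so the saturation
  of the program is inert on a genuine run; from `natAbs_gramZ_ampZ_le`);
* `touching_nonempty` — a nonempty wire set meets at least one block of a block partition;
  `wires_gate_nonempty` — a placed Clifford+`T` gate has a wire;
* **`gramZ_singleton_dpInit`** — the initial block data: on the basis vector `|w⟩` the datum of the
  singleton block `{i}` is `[u i = w i][v i = w i]`;
* `one_le_of_hasPBlockedStates` — on a nonempty register the block bound `p` is positive.

## References

* R. Jozsa, N. Linden, *On the role of entanglement in quantum-computational speed-up*, Proc. R.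
  Soc. Lond. A 459 (2003) 2011–2032, arXiv:quant-ph/0201143: §3, proof of lemma `ratpbl`
  ((a), (b), Cases 1 and 2), lemma `ratlemma`.
-/

noncomputable section

namespace Literature.Barriers.QuantumAdvantage

open Finset Literature.Computability.Cryptography Literature.Computability.QuantumComplexity

variable {N : ℕ}

/-! ### The Hadamard count and the width -/

section Family

variable (F : QCircuitFamily cliffordT) (x : List Bool)

/-- The Hadamard count is monotone along the computation. [folklore] -/
theorem hExp_mono {j j' : ℕ} (h : j ≤ j') : F.hExp x j ≤ F.hExp x j' := by
  unfold QCircuitFamily.hExp hCount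
  exact (List.take_sublist_take_left h).countP_le

/-- The Hadamard count is at most the number of gates. [folklore] -/
theorem hExp_le_length (j : ℕ) : F.hExp x j ≤ (F.circ x.length).gates.length := by
  unfold QCircuitFamily.hExp hCount
  exact List.countP_le_length.trans (List.take_sublist j _).length_le

/-- **The width bound**: with `W ≥ h_final + 2`, every coordinate of every block datum at every
stage is `< 2^W` in absolute value. [cite: JozsaLinden2003, §3 (lemma ratlemma; proof of lemma ratpbl, (b))] -/
theorem natAbs_gramZ_ampZ_lt_two_pow (hF : F.IsOracleFree) {W : ℕ}
    (hW : F.hExp x (F.circ x.length).gates.length + 2 ≤ W) (j : ℕ)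
    (B : Finset (Fin (x.length + F.ancillas x.length))) (u v : QReg (x.length + F.ancillas x.length)) (k : Fin 4) :
    ((gramZ B (F.ampZ x j) u v) k).natAbs < 2 ^ W := by
  have hj : F.hExp x j ≤ F.hExp x (F.circ x.length).gates.length := by
    by_cases h : j ≤ (F.circ x.length).gates.length
    · exact hExp_mono F x h
    · rw [hExp_of_length_le F x (not_le.1 h).le]
  calc ((gramZ B (F.ampZ x j) u v) k).natAbs ≤ 2 * 2 ^ F.hExp x j := natAbs_gramZ_ampZ_le F x hF j B u v k
    _ = 2 ^ (F.hExp x j + 1) := by rw [pow_succ, mul_comm]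
    _ < 2 ^ W := Nat.pow_lt_pow_right (by norm_num) (by omega)

/-- On a nonempty register the block bound of `HasPBlockedStates p` is positive (the initial
singleton blocks have one wire). [cite: JozsaLinden2003, §3 (theorem pblthm: "p a fixed positive integer")] -/
theorem one_le_of_hasPBlockedStates {p : ℕ} (hp : F.HasPBlockedStates p) (hN : 0 < x.length + F.ancillas x.length) :
    1 ≤ p := by
  have h := card_le_of_mem_blocksAfter (F := F) (x := x) hp 0 {⟨0, hN⟩}
    (by simp only [blocksAfter]; exact mem_image_of_mem _ (mem_univ _))
  rwa [card_singleton] at h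

end Family

/-! ### Touching blocks -/

/-- **A nonempty wire set meets at least one block** of a block partition. [folklore] -/
theorem touching_nonempty {ψ : QReg N → ℂ} {P : Finset (Finset (Fin N))} (hP : IsBlockPartition ψ P)
    {E : Finset (Fin N)} (hE : E.Nonempty) : (touching P E).Nonempty := by
  obtain ⟨i, hi⟩ := hE
  obtain ⟨B, hB, hiB⟩ := hP.cover i
  exact ⟨B, mem_filter.2 ⟨hB, ⟨i, mem_inter.2 ⟨hiB, hi⟩⟩⟩⟩

/-- A placed Clifford+`T` gate has at least one wire. [folklore] -/
theorem wires_gate_nonempty (op : CliffordTOp) (e : Fin (cliffordT.arity op) ↪ Fin N) :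
    (QGate.gate op e : QGate cliffordT N).wires.Nonempty := by
  have h0 : 0 < cliffordT.arity op := by cases op <;> decide
  exact ⟨e ⟨0, h0⟩, by simp [QGate.wires]⟩

/-- The wire set of a placed gate is the range of its placement. [folklore] -/
theorem mem_wires_gate_iff (op : CliffordTOp) (e : Fin (cliffordT.arity op) ↪ Fin N) (i : Fin N) :
    i ∈ (QGate.gate op e : QGate cliffordT N).wires ↔ ∃ k, e k = i := by
  simp [QGate.wires]

/-! ### The initial block data -/

/-- `cconj 1 = 1` in `ℤ[ω]`. [folklore] -/
@[simp] theorem cconj_one : ZW.cconj ZW.one = ZW.one := by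
  unfold ZW.cconj ZW.one
  ext k
  fin_cases k <;> rfl

/-- `cconj 0 = 0` in `ℤ[ω]`. [folklore] -/
@[simp] theorem cconj_zero : ZW.cconj 0 = 0 := by
  unfold ZW.cconj
  ext k
  fin_cases k <;> rfl

/-- **The initial block data**: on the basis vector `|w⟩` (`dpInit w`) the integral Gram datum of
the singleton block `{i}` is `[u i = w i][v i = w i]`.
[cite: JozsaLinden2003, §3 (proof of lemma ratpbl: the input state |i₁…iₙ⟩|0…0⟩ is a product of one-qubit states)] -/
theorem gramZ_singleton_dpInit (w u v : QReg N) (i : Fin N) :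
    gramZ {i} (dpInit w) u v = if u i = w i ∧ v i = w i then ZW.one else 0 := by
  classical
  unfold gramZ dpInit
  -- the only contributing complement configuration: `w` with wire `i` cleared
  set r₀ : QReg N := Function.update w i false with hr₀
  have hr₀mem : r₀ ∈ cfg ({i} : Finset (Fin N))ᶜ := by
    rw [mem_cfg]
    intro k hk
    rw [mem_compl, not_not, mem_singleton] at hk
    rw [hk, hr₀, Function.update_self]
  have hpiece : ∀ z r : QReg N, ({i} : Finset (Fin N)).piecewise z r = w ↔ z i = w i ∧ ∀ k, k ≠ i → r k = w k := by
    intro z r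
    constructor
    · intro h
      refine ⟨?_, fun k hk => ?_⟩
      · have := congrFun h i
        rwa [piecewise_eq_of_mem _ _ _ (mem_singleton_self i)] at this
      · have := congrFun h k
        rwa [piecewise_eq_of_notMem _ _ _ (by rwa [mem_singleton])] at this
    · rintro ⟨hz, hr⟩
      funext k
      by_cases hk : k = i
      · subst hk
        rwa [piecewise_eq_of_mem _ _ _ (mem_singleton_self _)]
      · rw [piecewise_eq_of_notMem _ _ _ (by rwa [mem_singleton])]
        exact hr k hk
  have hoff : ∀ r ∈ cfg ({i} : Finset (Fin N))ᶜ, (∀ k, k ≠ i → r k = w k) ↔ r = r₀ := by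
    intro r hr
    rw [mem_cfg] at hr
    have hri : r i = false := hr i (by simp)
    constructor
    · intro h
      funext k
      by_cases hk : k = i
      · subst hk
        rw [hri, hr₀, Function.update_self]
      · rw [hr₀, Function.update_of_ne hk, h k hk]
    · rintro rfl k hk
      rw [hr₀, Function.update_of_ne hk]
  rw [Finset.sum_eq_single_of_mem r₀ hr₀mem]
  · have h0 : ∀ k, k ≠ i → r₀ k = w k := fun k hk => by rw [hr₀, Function.update_of_ne hk]
    have hU : ({i} : Finset (Fin N)).piecewise u r₀ = w ↔ u i = w i :=
      (hpiece u r₀).trans ⟨fun h => h.1, fun h => ⟨h, h0⟩⟩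
    have hV : ({i} : Finset (Fin N)).piecewise v r₀ = w ↔ v i = w i :=
      (hpiece v r₀).trans ⟨fun h => h.1, fun h => ⟨h, h0⟩⟩
    simp only [hU, hV]
    by_cases hu : u i = w i <;> by_cases hv : v i = w i <;> simp [hu, hv]
  · intro r hr hne
    have hoff' : ¬ ∀ k, k ≠ i → r k = w k := fun h => hne ((hoff r hr).1 h)
    have hU : ¬ ({i} : Finset (Fin N)).piecewise u r = w := fun h => hoff' ((hpiece u r).1 h).2
    rw [if_neg hU, ZW.zero_mul]

end Literature.Barriers.QuantumAdvantage

end
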